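import Summits.Parity.GeneralizedHardyLittlewood.Theses.PrimeLevelFamEdge
import Literature.NumberTheory.LFunctions.KMVMomentAsymptoticsUniqueness

/-!
# `BeyondDiagonalBeatsQuarter` — Negative lane: the first correction at `Q = 1` is pinned by the
`Q = 1` first-moment display alone (refuter helper for stub S1 of the K_B line, ls-ref-1 g4)

The route's cruxes K_A `MomentsBeyondDiagonal` / K_B `BeyondDiagonalBeatsQuarter` carry
`KMV2000.MomentAsymptotics 1 Δ T₁ T₂`, which quantifies over EVERY admissible `P` and EVERY even-or-odd
`Q`; the deciding theorem `closes` consumes it only at `Q = 1` (via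
`goodMass_lower_of_momentAsymptotics`, `hMA P 1 …`). The K_B line's stub S1
(`stub_firstCorrectionVanishes`: `T₁ Δ' (X^2) 1 = 0`) therefore needs no information about derivatives
(`Q ≠ 1`): this file proves, sorry-free, that under `MomentAsymptotics Δlo Δhi T₁ T₂` the value
`T₁ Δ' P 1` vanishes as soon as the FIRST-moment display holds at `(P, Q = 1)` with ZERO correction on
the window — the second display and all `Q ≠ 1` displays are taken from the hypothesis itself
(pointwise uniqueness, `KMV2000.T₁_eq_of_momentAsymptotics_of_le_two`). So S1 reduces to ONE printed-
technology statement: the `Q = 1` mollified first harmonic moment at prime level for `q̂^{Δ'}`,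
`1 < Δ' < 2` (citable for `Δ' ≤ 6/5` from Ellenberg 2005, Thm. 1). No Theses statement is asserted.
-/

namespace Summit.Parity.GeneralizedHardyLittlewood.Theorems.BeyondDiagonalBeatsQuarter.Negative

open Polynomial
open Literature.NumberTheory.LFunctions
open Literature.NumberTheory.LFunctions.KMV2000

/-- **Uniqueness at `Q = 1` from the `Q = 1` first display alone.** If `(T₁, T₂)` is MA-consistent on
`(Δlo, Δhi]` and, for an admissible `P`, the FIRST-moment display holds at `(P, 1)` with zero
correction on the whole window, then `T₁ Δ' P 1 = 0` for every `Δ' ∈ (Δlo, Δhi]` with `0 < Δ' ≤ 2`.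
(Take `T₁' := T₁` off `(P, 1)` and `0` at `(P, 1)`, `T₂' := T₂`; the pair `(T₁', T₂')` is again
MA-consistent, and MA-consistent first corrections agree pointwise.) -/
theorem T₁_apply_one_eq_zero_of_firstDisplay {Δlo Δhi : ℝ} {T₁ T₂ : ℝ → ℝ[X] → ℝ[X] → ℝ}
    (h : MomentAsymptotics Δlo Δhi T₁ T₂) {P : ℝ[X]} (hP : KMV2000.Admissible P)
    (h1 : ∀ Δ : ℝ, Δlo < Δ → Δ ≤ Δhi →
      ∃ C : ℝ, ∃ q₀ : ℕ, ∀ (q : ℕ) [NeZero q], q.Prime → q₀ ≤ q →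
        (∀ n : ℕ, (n : ℝ) ≠ qhat q ^ Δ) →
          ‖LhPQ q P 1 (qhat q ^ Δ) -
              ((riemannZeta 2 * ((Real.sqrt (qhat q) / (Δ * Real.log (qhat q)) : ℝ) : ℂ)) *
                ((KMV2000.linForm Δ P 1 : ℝ) : ℂ))‖ ≤
            C * Real.sqrt (qhat q) * (Real.log (qhat q))⁻¹ ^ 2)
    {Δ' : ℝ} (h1' : Δlo < Δ') (h2' : Δ' ≤ Δhi) (hΔ'0 : 0 < Δ') (hΔ'2 : Δ' ≤ 2) :
    T₁ Δ' P 1 = 0 := by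
  classical
  -- the modified first correction: zero at `(P, 1)`, `T₁` elsewhere; the second correction is kept
  let T₁' : ℝ → ℝ[X] → ℝ[X] → ℝ := fun Δ P' Q ↦ if P' = P ∧ Q = 1 then 0 else T₁ Δ P' Q
  have hT₁'P : ∀ Δ, T₁' Δ P 1 = 0 := fun Δ ↦ by simp [T₁']
  have h' : MomentAsymptotics Δlo Δhi T₁' T₂ := by
    intro P' Q hP' hQ Δ hlo hhi
    by_cases hc : P' = P ∧ Q = 1
    · obtain ⟨rfl, rfl⟩ := hc
      obtain ⟨C₁, q₁, H₁⟩ := h1 Δ hlo hhi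
      obtain ⟨C₂, q₂, H₂⟩ := h P' 1 hP' hQ Δ hlo hhi
      refine ⟨max C₁ C₂, max (max q₁ q₂) 40, fun q _ hq hq₀ hM ↦ ⟨?_, ?_⟩⟩
      · have hA := H₁ q hq (le_trans (le_max_left _ _) (le_trans (le_max_left _ _) hq₀)) hM
        rw [hT₁'P Δ, add_zero]
        exact hA.trans (mul_le_mul_of_nonneg_right
          (mul_le_mul_of_nonneg_right (le_max_left _ _) (Real.sqrt_nonneg _)) (sq_nonneg _))
      · have hB := (H₂ q hq (le_trans (le_max_right _ _) (le_trans (le_max_left _ _) hq₀)) hM).2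
        have hq1 : 1 < qhat q := one_lt_qhat (le_trans (le_max_right _ _) hq₀)
        have hq' : 0 ≤ qhat q := le_of_lt (lt_trans zero_lt_one hq1)
        have hlog : 0 ≤ (Real.log (qhat q))⁻¹ ^ 3 :=
          pow_nonneg (inv_nonneg.mpr (Real.log_nonneg hq1.le)) 3
        exact hB.trans (mul_le_mul_of_nonneg_right
          (mul_le_mul_of_nonneg_right (le_max_right _ _) hq') hlog)
    · obtain ⟨C, q₀, H⟩ := h P' Q hP' hQ Δ hlo hhi
      refine ⟨C, q₀, fun q _ hq hq₀ hM ↦ ?_⟩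
      have e : T₁' Δ P' Q = T₁ Δ P' Q := by simp [T₁', hc]
      rw [e]
      exact H q hq hq₀ hM
  have key := T₁_eq_of_momentAsymptotics_of_le_two h h' hP isEvenOrOdd_one h1' h2' hΔ'0 hΔ'2
  rw [key]
  exact hT₁'P Δ'

end Summit.Parity.GeneralizedHardyLittlewood.Theorems.BeyondDiagonalBeatsQuarter.Negative
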